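import Literature.Probability.LatticeModels.DelaunayGraph
import Mathlib.Analysis.Convex.Segment
import Mathlib.Analysis.Complex.Basic
import HarnessLib

/-!
# Crossing Delaunay pairs have concyclic endpoints

Helper for crux stmt-CriticalPhenomena-6434
(`Summit.CriticalPhenomena.CardyFormulaZ2.Theses.CardyFlipRusso.SquareFromVoronoiHub`), line
`SketchIdeator5R2`, stub `stub_crossingDelaunay_cospherical`: if both diagonals `{A, C}` and `{B, D}`
of a planar quadrilateral whose diagonals cross are Delaunay pairs of a site set containing
`A, B, C, D` (closed empty-ball rule `IsDelaunayPair`), then `A, B, C, D` lie on a common circle.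
The proof is the affine power-of-a-point argument: the difference of the power functions of the two
empty balls is an affine function of the plane, `≤ 0` at `A, C` and `≥ 0` at `B, D`, hence `0` at the
crossing point and therefore `0` at `A` and `C`.
-/

noncomputable section

open Literature.Probability.LatticeModels (IsDelaunayPair)

namespace Summit.CriticalPhenomena.CardyFormulaZ2.Cruxes.SquareFromVoronoiHub.ProductLeg

/-- The squared distance of two complex numbers in coordinates. [folklore] -/
private theorem dist_sq_re_im (z w : ℂ) :
    dist z w ^ 2 = (z.re - w.re) ^ 2 + (z.im - w.im) ^ 2 := by
  rw [Complex.dist_eq_re_im, Real.sq_sqrt (by positivity)]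

/-- Real and imaginary parts of a two-point real combination in `ℂ`. [folklore] -/
private theorem re_im_of_combo {a b : ℝ} {P Q X : ℂ} (h : a • P + b • Q = X) :
    a * P.re + b * Q.re = X.re ∧ a * P.im + b * Q.im = X.im := by
  subst h
  simp

/-- The real-arithmetic core of the power-of-a-point argument: with `F` the (affine) difference of
the two power functions, `a F(A) + b F(C) = a' F(B) + b' F(D)` at the crossing point, the left side
is `≤ 0` termwise and the right side is `≥ 0` termwise, forcing `F(A) = 0`. [folklore] -/
private theorem power_core
    {a b a' b' r₁ r₂ xA yA xB yB xC yC xD yD p₁ q₁ p₂ q₂ : ℝ}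
    (ha : 0 < a) (hb : 0 < b) (ha' : 0 < a') (hb' : 0 < b')
    (hab : a + b = 1) (hab' : a' + b' = 1)
    (hx : a * xA + b * xC = a' * xB + b' * xD) (hy : a * yA + b * yC = a' * yB + b' * yD)
    (e₁ : r₁ ^ 2 = (xA - p₁) ^ 2 + (yA - q₁) ^ 2) (e₂ : r₁ ^ 2 = (xC - p₁) ^ 2 + (yC - q₁) ^ 2)
    (e₃ : r₂ ^ 2 = (xB - p₂) ^ 2 + (yB - q₂) ^ 2) (e₄ : r₂ ^ 2 = (xD - p₂) ^ 2 + (yD - q₂) ^ 2)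
    (i₂ : r₂ ^ 2 ≤ (xC - p₂) ^ 2 + (yC - q₂) ^ 2)
    (i₃ : r₁ ^ 2 ≤ (xB - p₁) ^ 2 + (yB - q₁) ^ 2) (i₄ : r₁ ^ 2 ≤ (xD - p₁) ^ 2 + (yD - q₁) ^ 2) :
    (xA - p₂) ^ 2 + (yA - q₂) ^ 2 ≤ r₂ ^ 2 := by
  -- the affine identity at the crossing point, with the on-sphere conditions substituted
  have key : a * (r₂ ^ 2 - ((xA - p₂) ^ 2 + (yA - q₂) ^ 2))
        + b * (r₂ ^ 2 - ((xC - p₂) ^ 2 + (yC - q₂) ^ 2))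
      = a' * ((xB - p₁) ^ 2 + (yB - q₁) ^ 2 - r₁ ^ 2)
        + b' * ((xD - p₁) ^ 2 + (yD - q₁) ^ 2 - r₁ ^ 2) := by
    linear_combination (2 * (p₂ - p₁)) * hx + (2 * (q₂ - q₁)) * hy
      + (p₁ ^ 2 - p₂ ^ 2 + q₁ ^ 2 - q₂ ^ 2 - r₁ ^ 2 + r₂ ^ 2) * hab
      - (p₁ ^ 2 - p₂ ^ 2 + q₁ ^ 2 - q₂ ^ 2 - r₁ ^ 2 + r₂ ^ 2) * hab'
      + a * e₁ + b * e₂ + a' * e₃ + b' * e₄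
  have hbC : 0 ≤ b * ((xC - p₂) ^ 2 + (yC - q₂) ^ 2 - r₂ ^ 2) :=
    mul_nonneg hb.le (sub_nonneg.2 i₂)
  have haB : 0 ≤ a' * ((xB - p₁) ^ 2 + (yB - q₁) ^ 2 - r₁ ^ 2) :=
    mul_nonneg ha'.le (sub_nonneg.2 i₃)
  have hbD : 0 ≤ b' * ((xD - p₁) ^ 2 + (yD - q₁) ^ 2 - r₁ ^ 2) :=
    mul_nonneg hb'.le (sub_nonneg.2 i₄)
  have haA : 0 ≤ a * (r₂ ^ 2 - ((xA - p₂) ^ 2 + (yA - q₂) ^ 2)) := by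
    linarith [key, hbC, haB, hbD]
  have := (mul_nonneg_iff_of_pos_left ha).1 haA
  linarith

/-- **Stub `stub_crossingDelaunay_cospherical` (line `SketchIdeator5R2`).** If the two diagonals
`{A, C}` and `{B, D}` of a planar quadrilateral cross (their open segments meet) and both are
Delaunay pairs of a site set `S ∋ A, B, C, D` for the closed empty-ball rule, then `A, B, C, D` are
concyclic: some centre `c` is at the same distance `r` from all four. [folklore] -/
theorem stub_crossingDelaunay_cospherical :
    ∀ (S : Set ℂ) (A B C D : ℂ), A ∈ S → B ∈ S → C ∈ S → D ∈ S →
      (∃ X : ℂ, X ∈ openSegment ℝ A C ∧ X ∈ openSegment ℝ B D) →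
      IsDelaunayPair S A C → IsDelaunayPair S B D →
        ∃ (c : ℂ) (r : ℝ), dist A c = r ∧ dist B c = r ∧ dist C c = r ∧ dist D c = r := by
  intro S A B C D hA hB hC hD hX hAC hBD
  obtain ⟨X, ⟨a, b, ha, hb, hab, hXAC⟩, ⟨a', b', ha', hb', hab', hXBD⟩⟩ := hX
  obtain ⟨c₁, r₁, hA₁, hC₁, h₁⟩ := hAC
  obtain ⟨c₂, r₂, hB₂, hD₂, h₂⟩ := hBD
  have hr₁ : 0 ≤ r₁ := hA₁ ▸ dist_nonneg
  have hr₂ : 0 ≤ r₂ := hB₂ ▸ dist_nonneg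
  -- coordinates of the crossing point
  obtain ⟨hx, hy⟩ := re_im_of_combo hXAC
  obtain ⟨hx', hy'⟩ := re_im_of_combo hXBD
  replace hx := hx.trans hx'.symm
  replace hy := hy.trans hy'.symm
  -- on-sphere equalities in coordinates
  have e₁ : r₁ ^ 2 = (A.re - c₁.re) ^ 2 + (A.im - c₁.im) ^ 2 := by rw [← hA₁, dist_sq_re_im]
  have e₂ : r₁ ^ 2 = (C.re - c₁.re) ^ 2 + (C.im - c₁.im) ^ 2 := by rw [← hC₁, dist_sq_re_im]
  have e₃ : r₂ ^ 2 = (B.re - c₂.re) ^ 2 + (B.im - c₂.im) ^ 2 := by rw [← hB₂, dist_sq_re_im]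
  have e₄ : r₂ ^ 2 = (D.re - c₂.re) ^ 2 + (D.im - c₂.im) ^ 2 := by rw [← hD₂, dist_sq_re_im]
  -- empty-ball inequalities in coordinates
  have i₁ : r₂ ^ 2 ≤ (A.re - c₂.re) ^ 2 + (A.im - c₂.im) ^ 2 := by
    rw [← dist_sq_re_im]; exact pow_le_pow_left₀ hr₂ (h₂ A hA) 2
  have i₂ : r₂ ^ 2 ≤ (C.re - c₂.re) ^ 2 + (C.im - c₂.im) ^ 2 := by
    rw [← dist_sq_re_im]; exact pow_le_pow_left₀ hr₂ (h₂ C hC) 2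
  have i₃ : r₁ ^ 2 ≤ (B.re - c₁.re) ^ 2 + (B.im - c₁.im) ^ 2 := by
    rw [← dist_sq_re_im]; exact pow_le_pow_left₀ hr₁ (h₁ B hB) 2
  have i₄ : r₁ ^ 2 ≤ (D.re - c₁.re) ^ 2 + (D.im - c₁.im) ^ 2 := by
    rw [← dist_sq_re_im]; exact pow_le_pow_left₀ hr₁ (h₁ D hD) 2
  -- the power-of-a-point argument, once for `A` and once (with `A ↔ C`, `b ↔ a`) for `C`
  have jA : (A.re - c₂.re) ^ 2 + (A.im - c₂.im) ^ 2 ≤ r₂ ^ 2 :=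
    power_core ha hb ha' hb' hab hab' hx hy e₁ e₂ e₃ e₄ i₂ i₃ i₄
  have jC : (C.re - c₂.re) ^ 2 + (C.im - c₂.im) ^ 2 ≤ r₂ ^ 2 :=
    power_core hb ha ha' hb' ((add_comm b a).trans hab) hab' ((add_comm _ _).trans hx)
      ((add_comm _ _).trans hy) e₂ e₁ e₃ e₄ i₁ i₃ i₄
  rw [← dist_sq_re_im] at jA jC
  refine ⟨c₂, r₂, ?_, hB₂, ?_, hD₂⟩
  · exact le_antisymm (le_of_pow_le_pow_left₀ two_ne_zero hr₂ jA) (h₂ A hA)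
  · exact le_antisymm (le_of_pow_le_pow_left₀ two_ne_zero hr₂ jC) (h₂ C hC)

end Summit.CriticalPhenomena.CardyFormulaZ2.Cruxes.SquareFromVoronoiHub.ProductLeg
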